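import Summits.QuantumFields.YangMills.Theses.TransportPerturbation

/-!
# Route `TransportPerturbation` — support `LoopStringLipschitz` (stmt-QuantumFields-26919): unit loop strings are measurable,
# bounded by `1` and `wd_K`-Lipschitz

Seat `ym-line-sfw-p1` g12 (2026-08-28).  Rung R3 is a RECORD-label rung (leaf `YM3TorusSU2`), not the Clay mass gap; this module is
elementary lattice bookkeeping and proves no step of any renormalisation-group argument.

The observable of a finite list `os` of unit loops at step `K` is `c ↦ Π_{C ∈ os} avgObs_K(C)(c)`, `avgObs_K(C)(c) = Re tr/2` of the
holonomy of the `K`-fold Bałaban block average `Ū^K(c)` along the representative walk of `C` (tree `T3Family.avgObs`, `T4Continuum.loopAt`).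
The cost is `wd_K(u,v) = Σ_{j ≤ K} L^{−(K−j)} inf_h sup_{p,a,b} |(Ū^j(u)_p)_{ab} − ((h·Ū^j(v))_p)_{ab}|` (inline in the route file).
PROOF of `loopStringLipschitz_proof : LoopStringLipschitz` with `A = Σ_{C ∈ os} 4·|C|` (`|C|` = word length, `4 = 2²`):
* §1 matrices: for unitary `X`, `Y` and any `D`, `|(X D Y)_{ab}| ≤ (#n)² max|D|`; telescoping along a walk,
  `|(X(𝒰_W(γ) − 𝒰_{W'}(γ)))_{ab}| ≤ (#n)² |γ| δ` for every unitary `X` whenever all link entries of `W`, `W'` differ by `≤ δ`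
  (backward steps: `(U⁻¹)_{ab} = conj U_{ba}`); hence `|Re tr/n|`-Lipschitz with the same constant.
* §2 lists: `|Π aᵢ − Π bᵢ| ≤ Σ |aᵢ − bᵢ|` for `|aᵢ|, |bᵢ| ≤ 1`; measurability and `|Π| ≤ 1`.
* §3 assembly: loop variables of CLOSED walks are gauge invariant (tree `loopAt_gaugeAct_walk`, `IsLoop.walkEnd_atLevel`), so for every
  level-`K` gauge transformation `h`, `|f u − f v| ≤ A · sup_{p,a,b}|Ū^K(u) − h·Ū^K(v)|`; take `inf_h` (`Real.mul_iInf_of_nonneg`,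
  `le_ciInf`) and bound the `j = K` term by the whole (termwise non-negative) sum `wd_K`.
No definitions, no named facts, no `sorry`.
-/

set_option autoImplicit false

noncomputable section

open MeasureTheory
open Literature.MathematicalPhysics.QuantumFieldTheory.Balaban1983to89
open Literature.MathematicalPhysics.QuantumFieldTheory.Balaban1983to89.T4Continuum

namespace Summit.QuantumFields.YangMills.Theorems.TransportPerturbation

/-! ## §1 Entrywise bounds for products of unitary matrices -/

section MatrixBounds

variable {n : Type} [Fintype n] [DecidableEq n]

/-- Entries of special unitary matrices have norm `≤ 1`. [folklore] -/
theorem su_entry_norm_le_one (A : Matrix.specialUnitaryGroup n ℂ) (a b : n) : ‖(A : Matrix n n ℂ) a b‖ ≤ 1 :=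
  entry_norm_bound_of_unitary A.2.1 a b

omit [DecidableEq n] in
/-- `|(X D Y)_{ab}| ≤ (#n)² δ` when the entries of `X`, `Y` are bounded by `1` and those of `D` by `δ`. [folklore] -/
theorem norm_mul_mul_apply_le {X Y D : Matrix n n ℂ} (hX : ∀ a b, ‖X a b‖ ≤ 1) (hY : ∀ a b, ‖Y a b‖ ≤ 1) {δ : ℝ}
    (hD : ∀ c d, ‖D c d‖ ≤ δ) (a b : n) :
    ‖(X * D * Y) a b‖ ≤ (Fintype.card n : ℝ) ^ 2 * δ := by
  rw [Matrix.mul_apply]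
  calc ‖∑ d, (X * D) a d * Y d b‖ ≤ ∑ d, ‖(X * D) a d * Y d b‖ := norm_sum_le _ _
    _ ≤ ∑ d : n, ∑ c : n, δ := by
        refine Finset.sum_le_sum fun d _ => ?_
        rw [norm_mul, Matrix.mul_apply]
        calc ‖∑ c, X a c * D c d‖ * ‖Y d b‖ ≤ ‖∑ c, X a c * D c d‖ * 1 :=
              mul_le_mul_of_nonneg_left (hY d b) (norm_nonneg _)
          _ = ‖∑ c, X a c * D c d‖ := mul_one _
          _ ≤ ∑ c, ‖X a c * D c d‖ := norm_sum_le _ _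
          _ ≤ ∑ c, δ := Finset.sum_le_sum fun c _ => by
              rw [norm_mul]
              calc ‖X a c‖ * ‖D c d‖ ≤ 1 * ‖D c d‖ := mul_le_mul_of_nonneg_right (hX a c) (norm_nonneg _)
                _ = ‖D c d‖ := one_mul _
                _ ≤ δ := hD c d
    _ = (Fintype.card n : ℝ) ^ 2 * δ := by
        simp only [Finset.sum_const, Finset.card_univ, nsmul_eq_mul]
        ring

variable [Nonempty n] {P : Params} {j : ℕ}

omit [Nonempty n] in
/-- The link matrix of one oriented step (`U(b)` or `U(b)⁻¹ = U(b)†`) differs entrywise by at most `δ` between two configurations whose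
links differ entrywise by at most `δ`. [folklore] -/
theorem step_entry_sub_le (W W' : GaugeField P j (Matrix.specialUnitaryGroup n ℂ)) {δ : ℝ}
    (hδ : ∀ (p : PBond P j) (a b : n), ‖(W p : Matrix n n ℂ) a b - (W' p : Matrix n n ℂ) a b‖ ≤ δ) (s : LStep P j) (c d : n) :
    ‖((if s.fwd then W s.bond else (W s.bond)⁻¹ : Matrix.specialUnitaryGroup n ℂ) : Matrix n n ℂ) c d -
        ((if s.fwd then W' s.bond else (W' s.bond)⁻¹ : Matrix.specialUnitaryGroup n ℂ) : Matrix n n ℂ) c d‖ ≤ δ := by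
  cases hs : s.fwd
  · simp only [Bool.false_eq_true, ↓reduceIte]
    show ‖(star (W s.bond : Matrix n n ℂ)) c d - (star (W' s.bond : Matrix n n ℂ)) c d‖ ≤ δ
    rw [Matrix.star_apply, Matrix.star_apply, ← star_sub, norm_star]
    exact hδ _ _ _
  · simp only [↓reduceIte]
    exact hδ _ _ _

/-- ★ **Holonomies are entrywise Lipschitz in the links**, uniformly after left multiplication by any unitary: if all link entries of
`W`, `W'` differ by at most `δ`, then `|(X·(𝒰_W(γ) − 𝒰_{W'}(γ)))_{ab}| ≤ (#n)²·|γ|·δ` (telescoping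
`X(gH − g'H') = X(g − g')H + (Xg')(H − H')`). [folklore] -/
theorem holAt_entry_sub_le (W W' : GaugeField P j (Matrix.specialUnitaryGroup n ℂ)) {δ : ℝ}
    (hδ : ∀ (p : PBond P j) (a b : n), ‖(W p : Matrix n n ℂ) a b - (W' p : Matrix n n ℂ) a b‖ ≤ δ) (γ : List (LStep P j)) :
    ∀ (X : Matrix.specialUnitaryGroup n ℂ) (a b : n),
      ‖((X : Matrix n n ℂ) * ((holAt W γ : Matrix.specialUnitaryGroup n ℂ) : Matrix n n ℂ) -
          (X : Matrix n n ℂ) * ((holAt W' γ : Matrix.specialUnitaryGroup n ℂ) : Matrix n n ℂ)) a b‖ ≤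
        (Fintype.card n : ℝ) ^ 2 * γ.length * δ := by
  induction γ with
  | nil =>
    intro X a b
    rw [holAt_nil, holAt_nil, sub_self, Matrix.zero_apply, norm_zero, List.length_nil, Nat.cast_zero, mul_zero, zero_mul]
  | cons s γ ih =>
    intro X a b
    rw [holAt_cons, holAt_cons]
    set g : Matrix.specialUnitaryGroup n ℂ := if s.fwd then W s.bond else (W s.bond)⁻¹ with hg
    set g' : Matrix.specialUnitaryGroup n ℂ := if s.fwd then W' s.bond else (W' s.bond)⁻¹ with hg'
    set H : Matrix.specialUnitaryGroup n ℂ := holAt W γ with hH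
    set H' : Matrix.specialUnitaryGroup n ℂ := holAt W' γ with hH'
    have hsplit : (X : Matrix n n ℂ) * ((g * H : Matrix.specialUnitaryGroup n ℂ) : Matrix n n ℂ) -
        (X : Matrix n n ℂ) * ((g' * H' : Matrix.specialUnitaryGroup n ℂ) : Matrix n n ℂ) =
        (X : Matrix n n ℂ) * ((g : Matrix n n ℂ) - (g' : Matrix n n ℂ)) * (H : Matrix n n ℂ) +
          (((X * g' : Matrix.specialUnitaryGroup n ℂ) : Matrix n n ℂ) * (H : Matrix n n ℂ) -
            ((X * g' : Matrix.specialUnitaryGroup n ℂ) : Matrix n n ℂ) * (H' : Matrix n n ℂ)) := by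
      simp only [Submonoid.coe_mul]
      noncomm_ring
    rw [hsplit, Matrix.add_apply]
    refine (norm_add_le _ _).trans ?_
    have h1 : ‖((X : Matrix n n ℂ) * ((g : Matrix n n ℂ) - (g' : Matrix n n ℂ)) * (H : Matrix n n ℂ)) a b‖ ≤
        (Fintype.card n : ℝ) ^ 2 * δ :=
      norm_mul_mul_apply_le (su_entry_norm_le_one X) (su_entry_norm_le_one H)
        (fun c d => by rw [Matrix.sub_apply]; exact step_entry_sub_le W W' hδ s c d) a b
    have h2 := ih (X * g') a b
    rw [List.length_cons, Nat.cast_succ]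
    have : (Fintype.card n : ℝ) ^ 2 * ((γ.length : ℝ) + 1) * δ =
        (Fintype.card n : ℝ) ^ 2 * δ + (Fintype.card n : ℝ) ^ 2 * γ.length * δ := by ring
    rw [this]
    exact add_le_add h1 h2

/-- ★ **Loop variables are Lipschitz in the links**: `|Re tr 𝒰_W(γ)/n − Re tr 𝒰_{W'}(γ)/n| ≤ (#n)²·|γ|·δ`. [folklore] -/
theorem loopAt_sub_le (W W' : GaugeField P j (Matrix.specialUnitaryGroup n ℂ)) {δ : ℝ}
    (hδ : ∀ (p : PBond P j) (a b : n), ‖(W p : Matrix n n ℂ) a b - (W' p : Matrix n n ℂ) a b‖ ≤ δ) (γ : List (LStep P j)) :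
    |loopAt W γ - loopAt W' γ| ≤ (Fintype.card n : ℝ) ^ 2 * γ.length * δ := by
  have hcard : (0 : ℝ) < Fintype.card n := by exact_mod_cast Fintype.card_pos
  -- `reTr g = Re tr g / #n` (tree instance through the fundamental representation)
  show |((((holAt W γ : Matrix.specialUnitaryGroup n ℂ) : Matrix n n ℂ).trace).re / Fintype.card n) -
      ((((holAt W' γ : Matrix.specialUnitaryGroup n ℂ) : Matrix n n ℂ).trace).re / Fintype.card n)| ≤ _
  rw [← sub_div, ← Complex.sub_re, ← Matrix.trace_sub, abs_div, abs_of_pos hcard, div_le_iff₀ hcard]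
  have hdiag := fun a : n => holAt_entry_sub_le W W' hδ γ 1 a a
  simp only [OneMemClass.coe_one, one_mul] at hdiag
  calc |((((holAt W γ : Matrix.specialUnitaryGroup n ℂ) : Matrix n n ℂ) -
          ((holAt W' γ : Matrix.specialUnitaryGroup n ℂ) : Matrix n n ℂ)).trace).re|
      ≤ ‖(((holAt W γ : Matrix.specialUnitaryGroup n ℂ) : Matrix n n ℂ) -
          ((holAt W' γ : Matrix.specialUnitaryGroup n ℂ) : Matrix n n ℂ)).trace‖ := Complex.abs_re_le_norm _
    _ ≤ ∑ a : n, ‖(((holAt W γ : Matrix.specialUnitaryGroup n ℂ) : Matrix n n ℂ) -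
          ((holAt W' γ : Matrix.specialUnitaryGroup n ℂ) : Matrix n n ℂ)) a a‖ := by
        rw [Matrix.trace]
        exact norm_sum_le _ _
    _ ≤ ∑ _a : n, (Fintype.card n : ℝ) ^ 2 * γ.length * δ := Finset.sum_le_sum fun a _ => hdiag a
    _ = (Fintype.card n : ℝ) ^ 2 * γ.length * δ * Fintype.card n := by
        simp only [Finset.sum_const, Finset.card_univ, nsmul_eq_mul]
        ring

end MatrixBounds

/-! ## §2 Finite products of `[-1, 1]`-valued functions -/

section Lists

variable {α β : Type}

/-- A product of reals of absolute value `≤ 1` has absolute value `≤ 1`. [folklore] -/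
theorem abs_prod_map_le_one (l : List α) (f : α → ℝ) (hf : ∀ C, |f C| ≤ 1) : |(l.map f).prod| ≤ 1 := by
  induction l with
  | nil => simp
  | cons C l ih =>
    rw [List.map_cons, List.prod_cons, abs_mul]
    calc |f C| * |(l.map f).prod| ≤ 1 * 1 := mul_le_mul (hf C) ih (abs_nonneg _) zero_le_one
      _ = 1 := one_mul _

/-- **Telescoping for products in `[-1,1]`**: `|Π f − Π g| ≤ Σ |f − g|`. [folklore] -/
theorem abs_prod_map_sub_prod_map_le (l : List α) (f g : α → ℝ) (hf : ∀ C, |f C| ≤ 1) (hg : ∀ C, |g C| ≤ 1) :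
    |(l.map f).prod - (l.map g).prod| ≤ (l.map fun C => |f C - g C|).sum := by
  induction l with
  | nil => simp
  | cons C l ih =>
    rw [List.map_cons, List.map_cons, List.map_cons, List.prod_cons, List.prod_cons, List.sum_cons]
    have hsplit : f C * (l.map f).prod - g C * (l.map g).prod =
        (f C - g C) * (l.map f).prod + g C * ((l.map f).prod - (l.map g).prod) := by ring
    rw [hsplit]
    refine (abs_add_le _ _).trans ?_
    rw [abs_mul, abs_mul]
    have h1 : |f C - g C| * |(l.map f).prod| ≤ |f C - g C| :=
      mul_le_of_le_one_right (abs_nonneg _) (abs_prod_map_le_one l f hf)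
    have h2 : |g C| * |(l.map f).prod - (l.map g).prod| ≤ (l.map fun C => |f C - g C|).sum :=
      (mul_le_of_le_one_left (abs_nonneg _) (hg C)).trans ih
    exact add_le_add h1 h2

/-- A finite product of measurable real functions is measurable. [folklore] -/
theorem measurable_prod_map [MeasurableSpace β] (l : List α) (f : α → β → ℝ) (hf : ∀ C, Measurable (f C)) :
    Measurable fun x => (l.map fun C => f C x).prod := by
  induction l with
  | nil => simp
  | cons C l ih =>
    simp only [List.map_cons, List.prod_cons]
    exact (hf C).mul ih

/-- Termwise comparison of mapped sums. [folklore] -/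
theorem sum_map_le_sum_map (l : List α) (f g : α → ℝ) (h : ∀ C, f C ≤ g C) : (l.map f).sum ≤ (l.map g).sum := by
  induction l with
  | nil => simp
  | cons C l ih =>
    simp only [List.map_cons, List.sum_cons]
    exact add_le_add (h C) ih

/-- A common right factor comes out of a mapped sum. [folklore] -/
theorem sum_map_mul_right (l : List α) (f : α → ℝ) (a : ℝ) : (l.map fun C => f C * a).sum = (l.map f).sum * a := by
  induction l with
  | nil => simp
  | cons C l ih =>
    simp only [List.map_cons, List.sum_cons]
    rw [ih, add_mul]

end Lists

/-! ## §3 Walk lengths and the assembly -/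

/-- The walk spelled by a word has the length of the word. [folklore] -/
theorem length_walk' {P : Params} {j : ℕ} : ∀ (x : Site P j) (w : List (Letter P.d)), (walk x w).length = w.length
  | _, [] => rfl
  | x, (μ, true) :: w => by rw [walk, List.length_cons, List.length_cons, length_walk' (x.shift μ) w]
  | x, (μ, false) :: w => by rw [walk, List.length_cons, List.length_cons, length_walk' (x.unshift μ) w]

/-- **The gauge-fixed core of the Lipschitz estimate**: for two level-`K` fields `W`, `W'` and ANY level-`K` gauge transformation `h`,
the loop-string products differ by at most `(Σ_{C ∈ os} 4|C|) · sup_{p,a,b} |W_p,ab − (h·W')_p,ab|` (closed loop variables do not see `h`).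
[cite: Balaban1985Averaging, (12) p.19] -/
theorem abs_prod_loopAt_sub_le_gauge (F : T3ContinuumYM3Torus.T3Family) (os : List (T3ContinuumYM3Torus.ULoop3 F)) (K : ℕ)
    (W W' : GaugeField (F.P K) K (Matrix.specialUnitaryGroup (Fin 2) ℂ))
    (h : GaugeTransf (F.P K) K (Matrix.specialUnitaryGroup (Fin 2) ℂ)) :
    |(os.map fun C : T3ContinuumYM3Torus.ULoop3 F => loopAt W (C.1.atLevel K)).prod -
        (os.map fun C : T3ContinuumYM3Torus.ULoop3 F => loopAt W' (C.1.atLevel K)).prod| ≤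
      (os.map fun C : T3ContinuumYM3Torus.ULoop3 F => (4 : ℝ) * C.1.word.length).sum *
        ⨆ p : PBond (F.P K) K × Fin 2 × Fin 2,
          ‖((W p.1 : Matrix.specialUnitaryGroup (Fin 2) ℂ) : Matrix (Fin 2) (Fin 2) ℂ) p.2.1 p.2.2 -
            ((GaugeField.gaugeAct h W' p.1 : Matrix.specialUnitaryGroup (Fin 2) ℂ) : Matrix (Fin 2) (Fin 2) ℂ) p.2.1 p.2.2‖ := by
  set δ : ℝ := ⨆ p : PBond (F.P K) K × Fin 2 × Fin 2,
    ‖((W p.1 : Matrix.specialUnitaryGroup (Fin 2) ℂ) : Matrix (Fin 2) (Fin 2) ℂ) p.2.1 p.2.2 -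
      ((GaugeField.gaugeAct h W' p.1 : Matrix.specialUnitaryGroup (Fin 2) ℂ) : Matrix (Fin 2) (Fin 2) ℂ) p.2.1 p.2.2‖ with hδ
  have hbdd : BddAbove (Set.range fun p : PBond (F.P K) K × Fin 2 × Fin 2 =>
      ‖((W p.1 : Matrix.specialUnitaryGroup (Fin 2) ℂ) : Matrix (Fin 2) (Fin 2) ℂ) p.2.1 p.2.2 -
        ((GaugeField.gaugeAct h W' p.1 : Matrix.specialUnitaryGroup (Fin 2) ℂ) : Matrix (Fin 2) (Fin 2) ℂ) p.2.1 p.2.2‖) := by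
    refine ⟨2, ?_⟩
    rintro _ ⟨p, rfl⟩
    refine (norm_sub_le _ _).trans ?_
    have := su_entry_norm_le_one (W p.1) p.2.1 p.2.2
    have := su_entry_norm_le_one (GaugeField.gaugeAct h W' p.1) p.2.1 p.2.2
    linarith
  have hδp : ∀ (p : PBond (F.P K) K) (a b : Fin 2),
      ‖((W p : Matrix.specialUnitaryGroup (Fin 2) ℂ) : Matrix (Fin 2) (Fin 2) ℂ) a b -
        ((GaugeField.gaugeAct h W' p : Matrix.specialUnitaryGroup (Fin 2) ℂ) : Matrix (Fin 2) (Fin 2) ℂ) a b‖ ≤ δ :=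
    fun p a b => le_ciSup hbdd (p, a, b)
  -- gauge invariance of closed loop variables: `loopAt W' = loopAt (h·W')` on every loop of `os`
  have hgauge : ∀ C : T3ContinuumYM3Torus.ULoop3 F,
      loopAt W' (C.1.atLevel K) = loopAt (GaugeField.gaugeAct h W') (C.1.atLevel K) :=
    fun C => (loopAt_gaugeAct_walk h W' _ _ (C.2.walkEnd_atLevel K)).symm
  simp only [hgauge]
  refine (abs_prod_map_sub_prod_map_le os _ _ (fun C => abs_loopAt_le_one _ _) (fun C => abs_loopAt_le_one _ _)).trans ?_
  calc (os.map fun C : T3ContinuumYM3Torus.ULoop3 F =>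
          |loopAt W (C.1.atLevel K) - loopAt (GaugeField.gaugeAct h W') (C.1.atLevel K)|).sum
      ≤ (os.map fun C : T3ContinuumYM3Torus.ULoop3 F => (4 : ℝ) * C.1.word.length * δ).sum := by
        refine sum_map_le_sum_map os _ _ fun C => ?_
        have hC := loopAt_sub_le W (GaugeField.gaugeAct h W') hδp (C.1.atLevel K)
        have hlen : (C.1.atLevel K).length = C.1.word.length := length_walk' _ _
        have h4 : (Fintype.card (Fin 2) : ℝ) ^ 2 = 4 := by norm_num
        rw [hlen, h4] at hC
        exact hC
    _ = (os.map fun C : T3ContinuumYM3Torus.ULoop3 F => (4 : ℝ) * C.1.word.length).sum * δ := sum_map_mul_right os _ δ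

/-- ★★ **`LoopStringLipschitz` (stmt-QuantumFields-26919)** BY NAME, with `A = Σ_{C ∈ os} 4·|C|`: for every family and every finite
list of unit loops the loop-string observable at every step `K` is measurable, bounded by `1`, and `A`-Lipschitz for `wd_K` (gauge
invariance of closed loop variables + entrywise Lipschitz holonomies + the `j = K` term of `wd_K`). [cite: Balaban1985Averaging, (12) p.19] -/
theorem loopStringLipschitz_proof : Summit.QuantumFields.YangMills.Theses.TransportPerturbation.LoopStringLipschitz := by
  intro F os
  have hℰ : F.AvgMeasurable (ExpMeanLog.expMeanLogSU : LoopAverage (Matrix.specialUnitaryGroup (Fin 2) ℂ)) :=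
    F.avgMeasurable_of_measurableE _ T4ApexTwoLevel.measurableE_expMeanLogSU
  have hA0 : 0 ≤ (os.map fun C : T3ContinuumYM3Torus.ULoop3 F => (4 : ℝ) * C.1.word.length).sum := by
    refine List.sum_nonneg ?_
    intro x hx
    rw [List.mem_map] at hx
    obtain ⟨C, _, rfl⟩ := hx
    positivity
  refine ⟨(os.map fun C : T3ContinuumYM3Torus.ULoop3 F => (4 : ℝ) * C.1.word.length).sum, hA0, fun K => ⟨?_, ?_, fun u v => ?_⟩⟩
  · -- measurability
    have hσ : Measurable fun c : Literature.MathematicalPhysics.QuantumFieldTheory.GaugeConfig 3 ((F.P K).sitesPerDir 0)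
        (Matrix.specialUnitaryGroup (Fin 2) ℂ) => fun b : PBond (F.P K) 0 => c (b.src, b.dir) :=
      measurable_pi_lambda _ fun b => measurable_pi_apply _
    have hm : ∀ C : T3ContinuumYM3Torus.ULoop3 F,
        Measurable fun c : Literature.MathematicalPhysics.QuantumFieldTheory.GaugeConfig 3 ((F.P K).sitesPerDir 0)
          (Matrix.specialUnitaryGroup (Fin 2) ℂ) =>
            F.avgObs (ExpMeanLog.expMeanLogSU : LoopAverage (Matrix.specialUnitaryGroup (Fin 2) ℂ)) K C
              (fun b : PBond (F.P K) 0 => c (b.src, b.dir)) :=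
      fun C => (F.measurable_avgObs hℰ K C).comp hσ
    exact measurable_prod_map os _ hm
  · -- `|Π| ≤ 1`
    intro u
    have hb : ∀ C : T3ContinuumYM3Torus.ULoop3 F,
        |F.avgObs (ExpMeanLog.expMeanLogSU : LoopAverage (Matrix.specialUnitaryGroup (Fin 2) ℂ)) K C
          (fun b : PBond (F.P K) 0 => u (b.src, b.dir))| ≤ 1 :=
      fun C => F.abs_avgObs_le_one _ K C _
    exact abs_prod_map_le_one os _ hb
  · -- Lipschitz: bound by the `j = K` term of `wd_K`, then take `inf_h` of the gauge-fixed core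
    refine le_trans ?_ (mul_le_mul_of_nonneg_left (Finset.single_le_sum (fun j _ => mul_nonneg
      (pow_nonneg (inv_nonneg.mpr (Nat.cast_nonneg _)) _) (Real.iInf_nonneg fun h => Real.iSup_nonneg fun p => norm_nonneg _))
      (Finset.mem_range.mpr (Nat.lt_succ_self K))) hA0)
    rw [Nat.sub_self, pow_zero, one_mul, Real.mul_iInf_of_nonneg hA0]
    haveI : Nonempty (GaugeTransf (F.P K) K (Matrix.specialUnitaryGroup (Fin 2) ℂ)) := ⟨fun _ => 1⟩
    exact le_ciInf fun h => abs_prod_loopAt_sub_le_gauge F os K _ _ h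

end Summit.QuantumFields.YangMills.Theorems.TransportPerturbation

end
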